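import Literature.MathematicalPhysics.QuantumFieldTheory.Balaban1983to89.B12Interfaces
import Literature.MathematicalPhysics.QuantumFieldTheory.Balaban1983to89.B12Eq210Scaling

/-!
# `Balaban1983to89.B12ActionExpansion26` — [Balaban1987RG1] (2.6)–(2.8) p. 266: the expansion of the action
`A(U_k(V′V^{(k)}))` in the fluctuation variables `B′` — (2.6) PROVED from the named inputs «the gauge invariance of the
action, and the formulas (41), (174) [15]», (2.8) PROVED with the remainder `V` made explicit; v1.1: [15] labels corrected
(ERRATUM), pointwise forms with print's B′-dependent 𝐀₁ = 𝒜₁(H₁B′)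

HONEST FRAMING (cell `lit-balaban`, verbatim): statement-level skeleton of published theorems with citation tags; proofs where landed; nothing here is a claim about the Yang–Mills mass gap.

CITATION HEADER.  T. Bałaban, *Renormalization group approach to lattice gauge field theories. I. Generation of
effective actions in a small field approximation and a coupling constant renormalization in four dimensions*,
Commun. Math. Phys. **109** (1987) 249–301, doi:10.1007/bf01215223 [Balaban1987RG1] (cell paper B12; held text
`paper:balaban1987-cmp109-rg-i-small-field`, journal page = PDF page + 248; the displays were READ AS AN IMAGE from
the page render `b2b-balaban-ref1/pages/1987-cmp109-rg-I-small-field/…-p018-x2.png` (p. 266)).  Unit `lit-balaban-r09`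
gen 4 (reader/typer of B12, display owner), SKELETON row `B12.Eq2.6-2.8` (status `typed-existing`, note «PARTIAL: (2.7)
= theorem `B12Interfaces.eq27_of_lagrange` (abstract orthogonality); (2.6), (2.8) NOT typed — need B11 (41), (174)
carriers»); HOME `run/shared/lean/pub/lit-balaban/`.  Siblings used BY NAME: `B12Interfaces` (Seam 2:
`eq27_of_lagrange` = (2.7)), `B12Eq15QuadraticForm` (p07: the (1.5) data `Data` — `H` = H_{1,k}, `Δ₁`, `pairJ` = ⟨·, J⟩),
`B12Eq210Scaling` (p07: `Setting.action28` = the display (2.8) carried as data with an abstract `Vpot`).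

WHAT IS PRINTED (p. 266 [PDF 18], verbatim).  *«Now we analyze an expansion of the action under the exponential in
(2.1). Using the gauge invariance of the action, and the formulas (41), (174) [15] we have
  A(U_k(V′V^{(k)})) = A(exp iη𝐇_k(B′)U_{k+1}) = A(U_{k+1}) + ⟨𝐇_k(B′), J_{k+1}⟩ + ½⟨𝐇_k(B′), Δ𝐇_k(B′)⟩ + V₀(𝐇_k(B′))
   = A(U_{k+1}) + ⟨H_{1,k}B′ + 𝐀_{1,k}, J_{k+1}⟩ − ⟨H_kD_k(H_{1,k}B′ + 𝐀_{1,k}), J_{k+1}⟩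
     + ½⟨H_{1,k}B′ + 𝐀_{1,k}, Δ(H_{1,k}B′ + 𝐀_{1,k})⟩ − ⟨H_{1,k}B′ + 𝐀_{1,k}, ΔH_kD_k(H_{1,k}B′ + 𝐀_{1,k})⟩
     + ½⟨H_kD_k(H_{1,k}B′ + 𝐀_{1,k}), ΔH_kD_k(H_{1,k}B′ + 𝐀_{1,k})⟩ + V₀(H_{1,k}B′ + 𝐀_{1,k} − H_kD_k(H_{1,k}B′ + 𝐀_{1,k})).
   (2.6)
Let us omit for simplicity the subscript k. By Eq. (171) [15] we have ⟨𝐀₁, J⟩ = 0. In the third term on the right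
hand side above we decompose the function D into the sum D^{(2)} + D₃, where D^{(2)} is the second order term equal to
C^{(2)}, and D₃ is the higher order remainder. The term with C^{(2)} together with the next term on the right hand side
of (2.6) yield the expression
  ½⟨H₁B′ + 𝐀₁, Δ₁(H₁B′ + 𝐀₁)⟩ = ½⟨H₁B′, Δ₁H₁B′⟩ + ½⟨𝐀₁, Δ₁𝐀₁⟩,   (2.7)
see the definitions (3.127), (3.128) [13]. Denoting terms of at least third order in H₁B′ by V(H₁B′) we get
  A(U_k(V′V^{(k)})) = A(U_{k+1}) + ⟨H₁B′, J⟩ + ½⟨H₁B′, Δ₁H₁B′⟩ + V(H₁B′).   (2.8)»*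
([15] = [Balaban1985Variational]: (41) p. 284 the functional «A(U₀) + ⟨A, J⟩ + ½⟨A, Δ_πA⟩ + V₀(A)», i.e. the expansion of the
action around the background ((26) p. 282 there; (3.12) of [13]), (171) p. 305 «𝔓*(U_k)J = 0» (⟨𝐀₁, J⟩ = 0), (174) p. 305 the
decomposition «𝓗 = 𝒜₁ + H₁B − HD(𝒜₁ + H₁B)» of the function 𝐇_k; [13] = [Balaban1985BackgroundPropagators]: (3.127)–(3.128)
the operators H₁, Δ₁.)

v1.1 ERRATUM (gen 46, 2026-08-24; [15] pp. 284/305 re-read first-hand in the held text layer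
`paper:balaban1985-cmp102-variational-background` p0008 L28, p0029 L19/L30).  v1.0 of this file had the two [15] labels
INTERCHANGED: it called the action expansion «(174)» (binder `h174`) and the decomposition of 𝐇_k «(41)» (binder `h41`), and
glossed them so in this docstring.  v1.1 RENAMES the binders — now `h41` = the action expansion (41) and `h174` = the
decomposition (174) — and corrects the glosses; the statements are otherwise byte-identical (binder names only; the one
importer, `B12ActionExpansion26Lattice`, applies these theorems with the hypotheses positional).  v1.0 also remarked that «the
constant ½⟨𝐀₁, Δ₁𝐀₁⟩ of (2.7) is B′-independent»: this misreads print — 𝐀₁ = 𝒜₁ of (174)–(175) [15] is a FUNCTION of H₁B′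
(«an analytic function of H₁B, hence of B … begins with a term of second order in H₁B», (176) p. 306), so ½⟨𝐀₁, Δ₁𝐀₁⟩ is of
fourth order in H₁B′ and belongs to V(H₁B′) genuinely, as printed.  The theorems of v1.0 take 𝐀₁ as a fixed vector with (174)
in ∀-form; they apply at each B′ separately; v1.1 §2 adds the POINTWISE forms `eq26_at`, `eq28_at` (hypotheses at the one
field B′, 𝐀₁ := 𝒜₁(B′)) and `V28fn` (V as a function of w = H₁B′ alone through 𝒜₁(w)), which is print's reading in full,
and `eq28_at_delta1` = `eq28_at` with the (3.127)–(3.128) input holding BY DEFINITION when `Δ₁` is taken to be the operator of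
the (3.127) [13] form (`h3127_of_delta1`, `delta1_symm_of`; lattice twin with body: `B12ActionExpansion26Lattice.delta1Form`);
§2b derives the Lagrange input of (2.7) from the PRINTED SHAPES (3.128), (3.129) [13] by polarization (`lagrange_of_eq3128`)
and gives (2.8) at one field with every binder a printed display or implied by one (`eq28_at_eq3128`).

HOW IT IS FORMALIZED (the dictionary; all modelling choices are here).  Over a field `𝕜` of characteristic zero
(ℝ; ℂ for the analytic extensions): `V` ∋ B′ (the fluctuation fields), `W` ∋ 𝐇 (fields on the fine lattice), `N`
(the range of the nonlinear map `D_k`), `𝒰` configurations with a gauge group `𝒢` acting by `•`.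
* `A : 𝒰 → 𝕜` the action, `U₁ : 𝒰` = U_{k+1}, `chart : W → 𝒰` = 𝐇 ↦ exp iη𝐇 U_{k+1}, `rep : V → 𝒰` = B′ ↦ U_k(V′V^{(k)})
  (V′ the function (2.4) of B′), `Hfn : V → W` = «the function 𝐇_k».  «The gauge invariance of the action» = `hA`;
  the representation U_k(V′V^{(k)}) = [exp iη𝐇_k(B′)U_{k+1}]^{gauge} on the domain `Dom` of B′ = `hrep` (Sect. C/G of
  [15]; the same named input as `B12FarTerms36.eq36` / (3.3)).
* (41) [15] = `h41 : ∀ 𝐇 ∈ DomH, A (chart 𝐇) = A U₁ + J 𝐇 + ½ β 𝐇 𝐇 + V₀ 𝐇` with `J = D.pairJ` (⟨·, J_{k+1}⟩),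
  `β` the symmetric pairing ⟨·, Δ ·⟩ (`hsymm`), `V₀ : W → 𝕜`; (174) [15] = `h174 : ∀ B′, Hfn B′ = (H₁B′ + 𝐀₁) − Hk (Dk
  (H₁B′ + 𝐀₁))` with `H₁ = D.H` (linear), `𝐀₁ : W`, `Hk : N →ₗ W` (the linear operator H_k), `Dk : W → N` (nonlinear)
  (v1.0 had these two labels interchanged — ERRATUM above).
  With `Y = H₁B′ + 𝐀₁`, `Z = H_kD_k(Y)` the third member of (2.6) is bilinear algebra — **`eq26`**.
* (171) [15] = `h171 : J 𝐀₁ = 0`; «D = D^{(2)} + D₃» = `hD : ∀ Y, Dk Y = C2 Y + D3 Y`; «the term with C^{(2)} together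
  with the next term … yield ½⟨Y, Δ₁Y⟩ … see the definitions (3.127), (3.128) [13]» = `h3127 : ∀ Y, −J(Hk(C2 Y)) +
  ½ β Y Y = ½ β₁ Y Y` with `β₁ = D.Δ₁`; (2.7) = `B12Interfaces.eq27_of_lagrange` from its printed mechanism
  (Δ₁H₁B′ = Q*ω, the Lagrange form of (3.129) [13]: `hlag`; Q𝐀₁ = 0: `hQA₁`; `β₁` symmetric: `hsymm₁`).  Then
  **`eq28`**: (2.8) with «the terms of at least third order in H₁B′» made EXPLICIT as the function `V28` (with body):
  `V(w) = ½⟨𝐀₁, Δ₁𝐀₁⟩ − ⟨H_kD₃(Y), J⟩ − ⟨Y, ΔZ⟩ + ½⟨Z, ΔZ⟩ + V₀(Y − Z)`, `Y = w + 𝐀₁`, `Z = H_kD_k(Y)`, `w = H₁B′` — the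
  terms of the last member of (2.6) not displayed in (2.8) after the two substitutions (print's «at least third order»
  is its ORDER CLAIM about these terms — D₃, V₀ of third order, 𝐀₁ = 𝒜₁(H₁B′) of second order by (176) [15], hence
  ½⟨𝐀₁, Δ₁𝐀₁⟩ of fourth order — and is not modelled; `V28` takes 𝐀₁ as a parameter, `V28fn` (§2) feeds it 𝒜₁(w)); and
  **`eq28_action28`**: (2.8) IS p07's `B12Eq210Scaling.Setting.action28` for the setting with `A := A(U_{k+1})`,
  `Vpot := V28`.
NOT HERE (not claimed): the constructions of 𝐇_k, H_{1,k}, 𝐀_{1,k}, H_k, D_k, Δ, Δ₁, J ([15] Sects. C, G; [13] Sect. D)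
and the proofs of (41), (171), (174), (3.127)–(3.129) (all carried as named hypotheses); the order/analyticity claims
(«D^{(2)} is the second order term equal to C^{(2)}», «terms of at least third order»); (2.9) ff.  No `sorry`, no axiom,
no named `Prop` fact; the only `def`s are `V28` and (v1.1) `V28fn` (with body).  The exact-background LATTICE instance of this
record ((41) [15] and the gauge invariance DISCHARGED there) is `B12ActionExpansion26Lattice` (gen 46).
-/

namespace Literature.MathematicalPhysics.QuantumFieldTheory.Balaban1983to89.B12ActionExpansion26

open B12Eq15QuadraticForm (Data)
open B12Eq210Scaling (Setting)

section Expansion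

variable {𝕜 : Type*} [Field 𝕜] [CharZero 𝕜] {V W X N : Type*} [AddCommGroup V] [Module 𝕜 V] [AddCommGroup W]
  [Module 𝕜 W] [AddCommGroup X] [Module 𝕜 X] [AddCommGroup N] [Module 𝕜 N]
  {𝒰 𝒢 : Type*} [SMul 𝒢 𝒰]

/-- **(2.6)** p. 266, PROVED from the named inputs: *«Using the gauge invariance of the action, and the formulas (41),
(174) [15] we have A(U_k(V′V^{(k)})) = A(exp iη𝐇_k(B′)U_{k+1}) = A(U_{k+1}) + ⟨𝐇_k(B′), J_{k+1}⟩ + ½⟨𝐇_k(B′), Δ𝐇_k(B′)⟩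
+ V₀(𝐇_k(B′)) = A(U_{k+1}) + ⟨Y, J_{k+1}⟩ − ⟨H_kD_k(Y), J_{k+1}⟩ + ½⟨Y, ΔY⟩ − ⟨Y, ΔH_kD_k(Y)⟩ + ½⟨H_kD_k(Y), ΔH_kD_k(Y)⟩
+ V₀(Y − H_kD_k(Y))»*, `Y = H_{1,k}B′ + 𝐀_{1,k}`.  Inputs: `hA` gauge invariance of `A`; `hrep` the representation of
U_k(V′V^{(k)}) as a gauge transform of exp iη𝐇_k(B′)U_{k+1} on `Dom`; `h41` = (41) [15] on `DomH` (the expansion of the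
action, with `β` = ⟨·, Δ·⟩ symmetric, `hsymm`); `h174` = (174) [15] (the decomposition of 𝐇_k, 𝐀₁ a fixed vector — pointwise
form `eq26_at`); `J = D.pairJ`, `H₁ = D.H` of the (1.5) data. [cite: Balaban1987RG1, (2.6) p.266]
[cite: Balaban1985Variational, (41) p.284, (174) p.305] -/
theorem eq26 (D : Data 𝕜 V W X) {A : 𝒰 → 𝕜} (hA : ∀ (g : 𝒢) (U : 𝒰), A (g • U) = A U)
    {rep : V → 𝒰} {chart : W → 𝒰} {Hfn : V → W} {Dom : Set V}
    (hrep : ∀ B ∈ Dom, ∃ g : 𝒢, rep B = g • chart (Hfn B))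
    {U₁ : 𝒰} {β : W →ₗ[𝕜] W →ₗ[𝕜] 𝕜} (hsymm : ∀ x y, β x y = β y x) {V₀ : W → 𝕜} {DomH : Set W}
    (h41 : ∀ H ∈ DomH, A (chart H) = A U₁ + D.pairJ H + (1 / 2 : 𝕜) * β H H + V₀ H)
    {A₁ : W} {Hk : N →ₗ[𝕜] W} {Dk : W → N}
    (h174 : ∀ B : V, Hfn B = (D.H B + A₁) - Hk (Dk (D.H B + A₁)))
    {B' : V} (hB : B' ∈ Dom) (hH : Hfn B' ∈ DomH) :
    A (rep B') = A U₁ + D.pairJ (D.H B' + A₁) - D.pairJ (Hk (Dk (D.H B' + A₁)))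
      + (1 / 2 : 𝕜) * β (D.H B' + A₁) (D.H B' + A₁) - β (D.H B' + A₁) (Hk (Dk (D.H B' + A₁)))
      + (1 / 2 : 𝕜) * β (Hk (Dk (D.H B' + A₁))) (Hk (Dk (D.H B' + A₁)))
      + V₀ ((D.H B' + A₁) - Hk (Dk (D.H B' + A₁))) := by
  obtain ⟨g, hg⟩ := hrep B' hB
  rw [hg, hA, h41 _ hH, h174 B']
  have h2 : β (Hk (Dk (D.H B' + A₁))) (D.H B' + A₁) = β (D.H B' + A₁) (Hk (Dk (D.H B' + A₁))) := hsymm _ _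
  simp only [map_sub, LinearMap.sub_apply, h2]
  ring

omit [CharZero 𝕜] in
/-- (2.6), the first two equalities only: *«A(U_k(V′V^{(k)})) = A(exp iη𝐇_k(B′)U_{k+1}) = A(U_{k+1}) + ⟨𝐇_k(B′), J_{k+1}⟩
+ ½⟨𝐇_k(B′), Δ𝐇_k(B′)⟩ + V₀(𝐇_k(B′))»* (gauge invariance + (41) [15]). [cite: Balaban1987RG1, (2.6) p.266]
[cite: Balaban1985Variational, (41) p.284] -/
theorem eq26_first (D : Data 𝕜 V W X) {A : 𝒰 → 𝕜} (hA : ∀ (g : 𝒢) (U : 𝒰), A (g • U) = A U)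
    {rep : V → 𝒰} {chart : W → 𝒰} {Hfn : V → W} {Dom : Set V}
    (hrep : ∀ B ∈ Dom, ∃ g : 𝒢, rep B = g • chart (Hfn B))
    {U₁ : 𝒰} {β : W →ₗ[𝕜] W →ₗ[𝕜] 𝕜} {V₀ : W → 𝕜} {DomH : Set W}
    (h41 : ∀ H ∈ DomH, A (chart H) = A U₁ + D.pairJ H + (1 / 2 : 𝕜) * β H H + V₀ H)
    {B' : V} (hB : B' ∈ Dom) (hH : Hfn B' ∈ DomH) :
    A (rep B') = A U₁ + D.pairJ (Hfn B') + (1 / 2 : 𝕜) * β (Hfn B') (Hfn B') + V₀ (Hfn B') := by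
  obtain ⟨g, hg⟩ := hrep B' hB
  rw [hg, hA, h41 _ hH]

/-- **V of (2.8)** — *«Denoting terms of at least third order in H₁B′ by V(H₁B′)»* — MADE EXPLICIT as a function of
`w = H₁B′`: with `Y = w + 𝐀₁`, `Z = H_kD_k(Y)`,
`V(w) = ½⟨𝐀₁, Δ₁𝐀₁⟩ − ⟨H_kD₃(Y), J⟩ − ⟨Y, ΔZ⟩ + ½⟨Z, ΔZ⟩ + V₀(Y − Z)` — the terms of the last member of (2.6) that
(2.8) does not display, after ⟨𝐀₁, J⟩ = 0, D = C^{(2)} + D₃ and (2.7) (`J = D.pairJ`, `β₁ = D.Δ₁` of the (1.5) data).  𝐀₁ is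
a PARAMETER here; print's 𝐀₁ = 𝒜₁(w) (a function of w = H₁B′, (174)–(176) [15]) is fed in by `V28fn` (v1.1 §2).
[cite: Balaban1987RG1, (2.8) p.266] -/
def V28 (D : Data 𝕜 V W X) (β : W →ₗ[𝕜] W →ₗ[𝕜] 𝕜) (V₀ : W → 𝕜) (A₁ : W) (Hk : N →ₗ[𝕜] W) (Dk D3 : W → N)
    (w : W) : 𝕜 :=
  (1 / 2 : 𝕜) * D.Δ₁ A₁ A₁ - D.pairJ (Hk (D3 (w + A₁))) - β (w + A₁) (Hk (Dk (w + A₁)))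
    + (1 / 2 : 𝕜) * β (Hk (Dk (w + A₁))) (Hk (Dk (w + A₁))) + V₀ ((w + A₁) - Hk (Dk (w + A₁)))

omit [CharZero 𝕜] in
/-- Unfolding of `V28`. [cite: Balaban1987RG1, (2.8) p.266] -/
theorem V28_apply (D : Data 𝕜 V W X) (β : W →ₗ[𝕜] W →ₗ[𝕜] 𝕜) (V₀ : W → 𝕜) (A₁ : W) (Hk : N →ₗ[𝕜] W)
    (Dk D3 : W → N) (w : W) :
    V28 D β V₀ A₁ Hk Dk D3 w
      = (1 / 2 : 𝕜) * D.Δ₁ A₁ A₁ - D.pairJ (Hk (D3 (w + A₁))) - β (w + A₁) (Hk (Dk (w + A₁)))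
        + (1 / 2 : 𝕜) * β (Hk (Dk (w + A₁))) (Hk (Dk (w + A₁))) + V₀ ((w + A₁) - Hk (Dk (w + A₁))) := rfl

/-- **(2.8)** p. 266, PROVED: *«A(U_k(V′V^{(k)})) = A(U_{k+1}) + ⟨H₁B′, J⟩ + ½⟨H₁B′, Δ₁H₁B′⟩ + V(H₁B′)»* with `V = V28`, from
(2.6) (`eq26`, its inputs `hA`, `hrep`, `h41` = (41) [15], `hsymm`, `h174` = (174) [15]) and the three substitutions of the
text: `h171` = (171) [15] ⟨𝐀₁, J⟩ = 0; `hD` = «D = D^{(2)} + D₃ … equal to C^{(2)}»; `h3127` = «the term with C^{(2)} together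
with the next term … yield ½⟨Y, Δ₁Y⟩» ((3.127), (3.128) [13]); and (2.7) by `B12Interfaces.eq27_of_lagrange` from its printed
mechanism — `hsymm₁` (Δ₁ symmetric), `hlag` (Δ₁H₁B′ = Q*ω, the Lagrange form of (3.129) [13] for the pairing `pair`),
`hQA₁` (Q𝐀₁ = 0).  Pointwise forms with print's 𝐀₁ = 𝒜₁(H₁B′): `eq28_at`, `eq28_at_delta1`. [cite: Balaban1987RG1, (2.8) p.266]
[cite: Balaban1985Variational, (41) p.284, (171) p.305, (174) p.305] -/
theorem eq28 (D : Data 𝕜 V W X) {A : 𝒰 → 𝕜} (hA : ∀ (g : 𝒢) (U : 𝒰), A (g • U) = A U)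
    {rep : V → 𝒰} {chart : W → 𝒰} {Hfn : V → W} {Dom : Set V}
    (hrep : ∀ B ∈ Dom, ∃ g : 𝒢, rep B = g • chart (Hfn B))
    {U₁ : 𝒰} {β : W →ₗ[𝕜] W →ₗ[𝕜] 𝕜} (hsymm : ∀ x y, β x y = β y x) {V₀ : W → 𝕜} {DomH : Set W}
    (h41 : ∀ H ∈ DomH, A (chart H) = A U₁ + D.pairJ H + (1 / 2 : 𝕜) * β H H + V₀ H)
    {A₁ : W} {Hk : N →ₗ[𝕜] W} {Dk : W → N}
    (h174 : ∀ B : V, Hfn B = (D.H B + A₁) - Hk (Dk (D.H B + A₁)))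
    (h171 : D.pairJ A₁ = 0) {C2 D3 : W → N} (hD : ∀ Y : W, Dk Y = C2 Y + D3 Y)
    (h3127 : ∀ Y : W, -D.pairJ (Hk (C2 Y)) + (1 / 2 : 𝕜) * β Y Y = (1 / 2 : 𝕜) * D.Δ₁ Y Y)
    (hsymm₁ : ∀ x y, D.Δ₁ x y = D.Δ₁ y x) {N' : Type*} [AddCommGroup N'] [Module 𝕜 N'] (Q : W →ₗ[𝕜] N')
    (pair : N' →ₗ[𝕜] N' →ₗ[𝕜] 𝕜) (ω : N') {B' : V} (hlag : ∀ a : W, D.Δ₁ a (D.H B') = pair (Q a) ω)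
    (hQA₁ : Q A₁ = 0) (hB : B' ∈ Dom) (hH : Hfn B' ∈ DomH) :
    A (rep B') = A U₁ + D.pairJ (D.H B') + (1 / 2 : 𝕜) * D.Δ₁ (D.H B') (D.H B') + V28 D β V₀ A₁ Hk Dk D3 (D.H B') := by
  rw [eq26 D hA hrep hsymm h41 h174 hB hH, V28_apply]
  -- (2.7) for h = H₁B′, a = 𝐀₁
  have h27 : D.Δ₁ (D.H B' + A₁) (D.H B' + A₁) = D.Δ₁ (D.H B') (D.H B') + D.Δ₁ A₁ A₁ :=
    B12Interfaces.eq27_of_lagrange D.Δ₁ hsymm₁ Q pair (D.H B') ω hlag hQA₁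
  -- «the term with C^{(2)} together with the next term» at Y = H₁B′ + 𝐀₁
  have hC := h3127 (D.H B' + A₁)
  -- ⟨H₁B′ + 𝐀₁, J⟩ = ⟨H₁B′, J⟩ by (171); D = C^{(2)} + D₃ inside ⟨H_kD_k(Y), J⟩
  have hJ : D.pairJ (D.H B' + A₁) = D.pairJ (D.H B') := by rw [map_add, h171, add_zero]
  have hDJ : D.pairJ (Hk (Dk (D.H B' + A₁)))
      = D.pairJ (Hk (C2 (D.H B' + A₁))) + D.pairJ (Hk (D3 (D.H B' + A₁))) := by
    rw [hD, map_add, map_add]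
  rw [hJ, hDJ]
  linear_combination hC + (1 / 2 : 𝕜) * h27

/-- **(2.8) is p07's `B12Eq210Scaling.Setting.action28`**: for a setting `S` over the same (1.5) data with
`S.A = A(U_{k+1})` and `S.Vpot = V28`, `A(U_k(V′V^{(k)})) = S.action28 B′` (under the inputs of `eq28`).
[cite: Balaban1987RG1, (2.8) p.266] -/
theorem eq28_action28 (S : Setting 𝕜 V W X) {A : 𝒰 → 𝕜} (hA : ∀ (g : 𝒢) (U : 𝒰), A (g • U) = A U)
    {rep : V → 𝒰} {chart : W → 𝒰} {Hfn : V → W} {Dom : Set V}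
    (hrep : ∀ B ∈ Dom, ∃ g : 𝒢, rep B = g • chart (Hfn B))
    {U₁ : 𝒰} {β : W →ₗ[𝕜] W →ₗ[𝕜] 𝕜} (hsymm : ∀ x y, β x y = β y x) {V₀ : W → 𝕜} {DomH : Set W}
    (h41 : ∀ H ∈ DomH, A (chart H) = A U₁ + S.D.pairJ H + (1 / 2 : 𝕜) * β H H + V₀ H)
    {A₁ : W} {Hk : N →ₗ[𝕜] W} {Dk : W → N}
    (h174 : ∀ B : V, Hfn B = (S.D.H B + A₁) - Hk (Dk (S.D.H B + A₁)))
    (h171 : S.D.pairJ A₁ = 0) {C2 D3 : W → N} (hD : ∀ Y : W, Dk Y = C2 Y + D3 Y)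
    (h3127 : ∀ Y : W, -S.D.pairJ (Hk (C2 Y)) + (1 / 2 : 𝕜) * β Y Y = (1 / 2 : 𝕜) * S.D.Δ₁ Y Y)
    (hsymm₁ : ∀ x y, S.D.Δ₁ x y = S.D.Δ₁ y x) {N' : Type*} [AddCommGroup N'] [Module 𝕜 N'] (Q : W →ₗ[𝕜] N')
    (pair : N' →ₗ[𝕜] N' →ₗ[𝕜] 𝕜) (ω : N') {B' : V} (hlag : ∀ a : W, S.D.Δ₁ a (S.D.H B') = pair (Q a) ω)
    (hQA₁ : Q A₁ = 0) (hB : B' ∈ Dom) (hH : Hfn B' ∈ DomH)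
    (hSA : S.A = A U₁) (hSV : S.Vpot = V28 S.D β V₀ A₁ Hk Dk D3) :
    A (rep B') = S.action28 B' := by
  rw [Setting.action28, hSA, hSV]
  exact eq28 S.D hA hrep hsymm h41 h174 h171 hD h3127 hsymm₁ Q pair ω hlag hQA₁ hB hH

/-! ## §2 (v1.1)  Pointwise forms — print's `B′`-dependent 𝐀₁ = 𝒜₁(H₁B′) of (174)–(176) [15] -/

/-- **(2.6) AT ONE FIELD `B′`** with the hypotheses at that field only: the representation `U_k(V′V^{(k)}) = g • chart(𝐇_k(B′))`
(`hrep`), (41) [15] at `𝐇 = 𝐇_k(B′)` (`h41`), and (174) [15] at `B′` with 𝐀₁ ANY vector — print's 𝐀₁ = 𝒜₁(B′) («an analytic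
function of H₁B, hence of B», [15] p. 306).  `w` stands for H₁B′. [cite: Balaban1987RG1, (2.6) p.266]
[cite: Balaban1985Variational, (41) p.284, (174) p.305] -/
theorem eq26_at (D : Data 𝕜 V W X) {A : 𝒰 → 𝕜} (hA : ∀ (g : 𝒢) (U : 𝒰), A (g • U) = A U)
    {chart : W → 𝒰} {repB : 𝒰} {HfnB : W} (hrep : ∃ g : 𝒢, repB = g • chart HfnB)
    {U₁ : 𝒰} {β : W →ₗ[𝕜] W →ₗ[𝕜] 𝕜} (hsymm : ∀ x y, β x y = β y x) {V₀ : W → 𝕜}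
    (h41 : A (chart HfnB) = A U₁ + D.pairJ HfnB + (1 / 2 : 𝕜) * β HfnB HfnB + V₀ HfnB)
    {w A₁ : W} {Hk : N →ₗ[𝕜] W} {Dk : W → N} (h174 : HfnB = (w + A₁) - Hk (Dk (w + A₁))) :
    A repB = A U₁ + D.pairJ (w + A₁) - D.pairJ (Hk (Dk (w + A₁)))
      + (1 / 2 : 𝕜) * β (w + A₁) (w + A₁) - β (w + A₁) (Hk (Dk (w + A₁)))
      + (1 / 2 : 𝕜) * β (Hk (Dk (w + A₁))) (Hk (Dk (w + A₁)))
      + V₀ ((w + A₁) - Hk (Dk (w + A₁))) := by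
  obtain ⟨g, hg⟩ := hrep
  rw [hg, hA, h41, h174]
  have h2 : β (Hk (Dk (w + A₁))) (w + A₁) = β (w + A₁) (Hk (Dk (w + A₁))) := hsymm _ _
  simp only [map_sub, LinearMap.sub_apply, h2]
  ring

/-- **V of (2.8) AS A FUNCTION OF `w = H₁B′` ALONE**, print's reading: `V28` with 𝐀₁ := 𝒜₁(w) a function of w ((174)–(176)
[15]: 𝒜₁ «is an analytic function of H₁B … begins with a term of second order in H₁B»).
[cite: Balaban1987RG1, (2.8) p.266] [cite: Balaban1985Variational, (174)-(176) p.305-306] -/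
def V28fn (D : Data 𝕜 V W X) (β : W →ₗ[𝕜] W →ₗ[𝕜] 𝕜) (V₀ : W → 𝕜) (𝒜 : W → W) (Hk : N →ₗ[𝕜] W) (Dk D3 : W → N)
    (w : W) : 𝕜 :=
  V28 D β V₀ (𝒜 w) Hk Dk D3 w

omit [CharZero 𝕜] in
/-- Unfolding of `V28fn`. [cite: Balaban1987RG1, (2.8) p.266] -/
theorem V28fn_apply (D : Data 𝕜 V W X) (β : W →ₗ[𝕜] W →ₗ[𝕜] 𝕜) (V₀ : W → 𝕜) (𝒜 : W → W) (Hk : N →ₗ[𝕜] W)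
    (Dk D3 : W → N) (w : W) : V28fn D β V₀ 𝒜 Hk Dk D3 w = V28 D β V₀ (𝒜 w) Hk Dk D3 w := rfl

/-- **(2.8) AT ONE FIELD `B′`, PRINT'S READING** (𝐀₁ = 𝒜₁(H₁B′) a function of H₁B′): from (2.6) at the point (`eq26_at`) and the
three substitutions of the text — (171) [15] ⟨𝒜₁(H₁B′), J⟩ = 0 (`h171`), «D = D^{(2)} + D₃» (`hD`), the (3.127)–(3.128) [13]
identity (`h3127`) — and (2.7) by `B12Interfaces.quadForm_add_of_orthogonal` (Seam 2): the Lagrange form of (3.129) [13] asked ON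
THE LANDAU-GAUGE TEST FIELDS only (`hlag : RD*a = 0 → ⟨a, Δ₁H₁B′⟩ = ⟨Qa, ω⟩`) and the membership `Q𝒜₁ = 0`, `RD*𝒜₁ = 0` ((175)
+ (19)–(21) [15]).  MODELLING NOTE (located, v1.1): v1.0's `eq28` asks `h3127` for every Y AND the Lagrange form for every test
field a; print's Δ₁ — the operator of the (3.127) form «½⟨A, ΔA⟩ − ⟨HC^{(2)}(A), J⟩», which makes `h3127` an identity — has the
Lagrange property only for RD*a = 0 (the gauge-invariant extension and the gauge-fixing terms enter first in (3.128)); the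
restricted form below is the one print's objects satisfy (cf. `B12ActionExpansion26Lattice.eq28_lattice_at_delta1Form`, where Δ₁
carries its body).  Conclusion: `A(U_k(V′V^{(k)})) = A(U_{k+1}) + ⟨H₁B′, J⟩ + ½⟨H₁B′, Δ₁H₁B′⟩ + V(H₁B′)`, `V = V28fn`.
[cite: Balaban1987RG1, (2.7) p.266, (2.8) p.266] [cite: Balaban1985Variational, (171) p.305, (174)-(176) p.305-306]
[cite: Balaban1985BackgroundPropagators, (3.127)-(3.129) p.421] -/
theorem eq28_at (D : Data 𝕜 V W X) {A : 𝒰 → 𝕜} (hA : ∀ (g : 𝒢) (U : 𝒰), A (g • U) = A U)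
    {chart : W → 𝒰} {repB : 𝒰} {HfnB : W} (hrep : ∃ g : 𝒢, repB = g • chart HfnB)
    {U₁ : 𝒰} {β : W →ₗ[𝕜] W →ₗ[𝕜] 𝕜} (hsymm : ∀ x y, β x y = β y x) {V₀ : W → 𝕜}
    (h41 : A (chart HfnB) = A U₁ + D.pairJ HfnB + (1 / 2 : 𝕜) * β HfnB HfnB + V₀ HfnB)
    {𝒜 : W → W} {Hk : N →ₗ[𝕜] W} {Dk : W → N} {B' : V}
    (h174 : HfnB = (D.H B' + 𝒜 (D.H B')) - Hk (Dk (D.H B' + 𝒜 (D.H B'))))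
    (h171 : D.pairJ (𝒜 (D.H B')) = 0) {C2 D3 : W → N} (hD : ∀ Y : W, Dk Y = C2 Y + D3 Y)
    (h3127 : ∀ Y : W, -D.pairJ (Hk (C2 Y)) + (1 / 2 : 𝕜) * β Y Y = (1 / 2 : 𝕜) * D.Δ₁ Y Y)
    (hsymm₁ : ∀ x y, D.Δ₁ x y = D.Δ₁ y x) {N' N'' : Type*} [AddCommGroup N'] [Module 𝕜 N'] [AddCommGroup N'']
    [Module 𝕜 N''] (Q : W →ₗ[𝕜] N') (RDstar : W →ₗ[𝕜] N'') (pair : N' →ₗ[𝕜] N' →ₗ[𝕜] 𝕜) (ω : N')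
    (hlag : ∀ a : W, RDstar a = 0 → D.Δ₁ a (D.H B') = pair (Q a) ω)
    (hQA₁ : Q (𝒜 (D.H B')) = 0) (hRA₁ : RDstar (𝒜 (D.H B')) = 0) :
    A repB = A U₁ + D.pairJ (D.H B') + (1 / 2 : 𝕜) * D.Δ₁ (D.H B') (D.H B')
      + V28fn D β V₀ 𝒜 Hk Dk D3 (D.H B') := by
  rw [eq26_at D hA hrep hsymm h41 h174, V28fn_apply, V28_apply]
  have h27 : D.Δ₁ (D.H B' + 𝒜 (D.H B')) (D.H B' + 𝒜 (D.H B'))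
      = D.Δ₁ (D.H B') (D.H B') + D.Δ₁ (𝒜 (D.H B')) (𝒜 (D.H B')) :=
    B12Interfaces.quadForm_add_of_orthogonal D.Δ₁ hsymm₁ (LinearMap.ker Q ⊓ LinearMap.ker RDstar) (D.H B')
      (fun a ha => by
        rw [Submodule.mem_inf, LinearMap.mem_ker, LinearMap.mem_ker] at ha
        rw [hlag a ha.2, ha.1, map_zero, LinearMap.zero_apply])
      (Submodule.mem_inf.mpr ⟨LinearMap.mem_ker.mpr hQA₁, LinearMap.mem_ker.mpr hRA₁⟩)
  have hC := h3127 (D.H B' + 𝒜 (D.H B'))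
  have hJ : D.pairJ (D.H B' + 𝒜 (D.H B')) = D.pairJ (D.H B') := by rw [map_add, h171, add_zero]
  have hDJ : D.pairJ (Hk (Dk (D.H B' + 𝒜 (D.H B'))))
      = D.pairJ (Hk (C2 (D.H B' + 𝒜 (D.H B')))) + D.pairJ (Hk (D3 (D.H B' + 𝒜 (D.H B')))) := by
    rw [hD, map_add, map_add]
  rw [hJ, hDJ]
  linear_combination hC + (1 / 2 : 𝕜) * h27

/-- **THE (3.127) SENTENCE BY DEFINITION (abstract form).**  «The term with C^{(2)} together with the next term on the right
hand side of (2.6) yield the expression ½⟨Y, Δ₁Y⟩ … see the definitions (3.127), (3.128) [13]»: when the (1.5) datum `Δ₁` IS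
the operator of the (3.127) [13] form «½⟨A, ΔA⟩ − ⟨HC^{(2)}(A), J⟩», i.e. `Δ₁(A, B) = β(A, B) − 2⟨H_kC₂(A, B), J⟩` with `C₂`
the polar form of `C^{(2)}` (`hΔ`), the input `h3127` of `eq28` / `eq28_at` holds identically (lattice twin WITH BODY:
`B12ActionExpansion26Lattice.delta1Form` / `h3127_delta1Form`). [cite: Balaban1987RG1, (2.7) p.266]
[cite: Balaban1985BackgroundPropagators, (3.127) p.421] -/
theorem h3127_of_delta1 (D : Data 𝕜 V W X) (β : W →ₗ[𝕜] W →ₗ[𝕜] 𝕜) (Hk : N →ₗ[𝕜] W) (C₂ : W →ₗ[𝕜] W →ₗ[𝕜] N)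
    (hΔ : D.Δ₁ = β - (2 : 𝕜) • C₂.compr₂ (D.pairJ ∘ₗ Hk)) (Y : W) :
    -D.pairJ (Hk (C₂ Y Y)) + (1 / 2 : 𝕜) * β Y Y = (1 / 2 : 𝕜) * D.Δ₁ Y Y := by
  rw [hΔ]
  simp only [LinearMap.sub_apply, LinearMap.smul_apply, LinearMap.compr₂_apply, LinearMap.coe_comp,
    Function.comp_apply, smul_eq_mul]
  ring

omit [CharZero 𝕜] in
/-- Such a `Δ₁` is symmetric when `β` and `C₂` are. [cite: Balaban1987RG1, (2.7) p.266]
[cite: Balaban1985BackgroundPropagators, (3.127) p.421] -/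
theorem delta1_symm_of (D : Data 𝕜 V W X) {β : W →ₗ[𝕜] W →ₗ[𝕜] 𝕜} (hsymm : ∀ x y, β x y = β y x) (Hk : N →ₗ[𝕜] W)
    {C₂ : W →ₗ[𝕜] W →ₗ[𝕜] N} (hC : ∀ x y, C₂ x y = C₂ y x)
    (hΔ : D.Δ₁ = β - (2 : 𝕜) • C₂.compr₂ (D.pairJ ∘ₗ Hk)) (x y : W) : D.Δ₁ x y = D.Δ₁ y x := by
  rw [hΔ]
  simp only [LinearMap.sub_apply, LinearMap.smul_apply, LinearMap.compr₂_apply, LinearMap.coe_comp,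
    Function.comp_apply, hsymm x y, hC x y]

/-- **(2.8) AT ONE FIELD WITH THE (3.127) INPUT DISCHARGED BY DEFINITION**: `eq28_at` for a (1.5) record whose `Δ₁` is the
operator of the (3.127) [13] form (`hΔ`, with `D^{(2)} = C^{(2)}`, `C^{(2)}(Y) = C₂(Y, Y)`: `hD`); remaining NAMED INPUTS: gauge
invariance `hA`, the representation `hrep`, (41) [15] `h41`, (174) [15] `h174`, (171) `h171`, the Lagrange form of (3.129) on
the Landau-gauge test fields `hlag`, and the membership `hQA₁`, `hRA₁`. [cite: Balaban1987RG1, (2.7) p.266, (2.8) p.266]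
[cite: Balaban1985Variational, (171) p.305, (174) p.305] [cite: Balaban1985BackgroundPropagators, (3.127)-(3.129) p.421] -/
theorem eq28_at_delta1 (D : Data 𝕜 V W X) {A : 𝒰 → 𝕜} (hA : ∀ (g : 𝒢) (U : 𝒰), A (g • U) = A U)
    {chart : W → 𝒰} {repB : 𝒰} {HfnB : W} (hrep : ∃ g : 𝒢, repB = g • chart HfnB)
    {U₁ : 𝒰} {β : W →ₗ[𝕜] W →ₗ[𝕜] 𝕜} (hsymm : ∀ x y, β x y = β y x) {V₀ : W → 𝕜}
    (h41 : A (chart HfnB) = A U₁ + D.pairJ HfnB + (1 / 2 : 𝕜) * β HfnB HfnB + V₀ HfnB)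
    {𝒜 : W → W} {Hk : N →ₗ[𝕜] W} {Dk : W → N} {B' : V}
    (h174 : HfnB = (D.H B' + 𝒜 (D.H B')) - Hk (Dk (D.H B' + 𝒜 (D.H B'))))
    (h171 : D.pairJ (𝒜 (D.H B')) = 0) {C₂ : W →ₗ[𝕜] W →ₗ[𝕜] N} (hC : ∀ x y, C₂ x y = C₂ y x) {D3 : W → N}
    (hD : ∀ Y : W, Dk Y = C₂ Y Y + D3 Y) (hΔ : D.Δ₁ = β - (2 : 𝕜) • C₂.compr₂ (D.pairJ ∘ₗ Hk))
    {N' N'' : Type*} [AddCommGroup N'] [Module 𝕜 N'] [AddCommGroup N''] [Module 𝕜 N''] (Q : W →ₗ[𝕜] N')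
    (RDstar : W →ₗ[𝕜] N'') (pair : N' →ₗ[𝕜] N' →ₗ[𝕜] 𝕜) (ω : N')
    (hlag : ∀ a : W, RDstar a = 0 → D.Δ₁ a (D.H B') = pair (Q a) ω)
    (hQA₁ : Q (𝒜 (D.H B')) = 0) (hRA₁ : RDstar (𝒜 (D.H B')) = 0) :
    A repB = A U₁ + D.pairJ (D.H B') + (1 / 2 : 𝕜) * D.Δ₁ (D.H B') (D.H B')
      + V28fn D β V₀ 𝒜 Hk Dk D3 (D.H B') :=
  eq28_at D hA hrep hsymm h41 h174 h171 (C2 := fun Y => C₂ Y Y) hD (h3127_of_delta1 D β Hk C₂ hΔ)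
    (delta1_symm_of D hsymm Hk hC hΔ) Q RDstar pair ω hlag hQA₁ hRA₁

/-! ### §2b (v1.1)  The Lagrange input DERIVED from the printed shapes (3.128)–(3.129) [13] -/

/-- **THE LAGRANGE FORM OF (3.129) [13] FROM THE PRINTED DISPLAYS (3.128), (3.129).**  Print ([13] p. 421): *«Let us denote
the operator defined by the problem (3.127), (3.110) by H₁, and by G₁ the operator defined by the quadratic form
⟨A, G₁⁻¹A⟩ = ⟨(A − DG′RD*A), Δ(A − DG′RD*A)⟩ − 2⟨HC₁^{(2)}(A − DG′RD*A), J⟩ + ‖RD*A‖² + a‖QA‖². (3.128)  Then we have the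
formula  H₁B = G₁Q*(QG₁Q*)⁻¹B. (3.129)»*.  LETTERS: `G1inv` = the symmetric form `⟨·, G₁⁻¹·⟩`; `Δ₁` = the symmetric form of
the operator of (3.127) (its first two terms, `⟨X, ΔX⟩ − 2⟨HC^{(2)}(X), J⟩ = Δ₁(X, X)`); `DGp` = the composite letter `DG′`;
`RDstar` = `RD*`; `Q`; `pair` ∕ `pairR` = the inner products in which `‖QA‖²`, `‖RD*A‖²` are taken; `α` = print's `a`.
HYPOTHESES, each the printed display verbatim or implied by it: `h3128` = (3.128) AS PRINTED (the quadratic form, diagonal);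
`h3129` = (3.129) read through `G₁⁻¹`: `G₁⁻¹(H₁B′) = Q*w`, `w = (QG₁Q*)⁻¹B′`, paired with a test field `a` (`⟨a, Q*w⟩ = ⟨Qa, w⟩`,
the definition of the adjoint); `hRh` = «RD*H₁B′ = 0» (the restriction (3.110) ∕ (45) [15] satisfied by the minimiser).
CONCLUSION (polarization, characteristic ≠ 2): on the Landau-gauge test fields `RD*a = 0`,
`Δ₁(a, H₁B′) = ⟨Qa, w − αQH₁B′⟩` — the hypothesis `hlag` of `eq28_at` ∕ `eq28_at_delta1` with `ω := w − α • QH₁B′`.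
[cite: Balaban1985BackgroundPropagators, (3.128) p.421, (3.129) p.421] [cite: Balaban1987RG1, (2.7) p.266] -/
theorem lagrange_of_eq3128 (Δ₁ G1inv : W →ₗ[𝕜] W →ₗ[𝕜] 𝕜) (hΔs : ∀ x y, Δ₁ x y = Δ₁ y x)
    (hGs : ∀ x y, G1inv x y = G1inv y x) {N' N'' : Type*} [AddCommGroup N'] [Module 𝕜 N'] [AddCommGroup N'']
    [Module 𝕜 N''] (Q : W →ₗ[𝕜] N') (RDstar : W →ₗ[𝕜] N'') (DGp : N'' →ₗ[𝕜] W) (pair : N' →ₗ[𝕜] N' →ₗ[𝕜] 𝕜)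
    (hps : ∀ x y, pair x y = pair y x) (pairR : N'' →ₗ[𝕜] N'' →ₗ[𝕜] 𝕜) (α : 𝕜)
    (h3128 : ∀ A : W, G1inv A A = Δ₁ (A - DGp (RDstar A)) (A - DGp (RDstar A))
      + pairR (RDstar A) (RDstar A) + α * pair (Q A) (Q A))
    {h : W} {w : N'} (h3129 : ∀ a : W, G1inv a h = pair (Q a) w) (hRh : RDstar h = 0)
    (a : W) (ha : RDstar a = 0) : Δ₁ a h = pair (Q a) (w - α • Q h) := by
  have hah : RDstar (a + h) = 0 := by rw [map_add, ha, hRh, add_zero]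
  have e1 := h3128 (a + h)
  have e2 := h3128 a
  have e3 := h3128 h
  simp only [hah, ha, hRh, map_zero, sub_zero, add_zero] at e1 e2 e3
  simp only [map_add, LinearMap.add_apply] at e1
  rw [hGs h a, hΔs h a, hps (Q h) (Q a)] at e1
  have e4 := h3129 a
  have key : (2 : 𝕜) * G1inv a h = 2 * Δ₁ a h + 2 * (α * pair (Q a) (Q h)) := by
    linear_combination e1 - e2 - e3
  rw [map_sub, map_smul, smul_eq_mul]
  linear_combination e4 - (1 / 2 : 𝕜) * key

/-- **(2.8) AT ONE FIELD FROM THE PRINTED SHAPES ONLY**: `eq28_at_delta1` with its Lagrange hypothesis DISCHARGED by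
`lagrange_of_eq3128` — the remaining binders are, each, a printed display verbatim or implied by it, applied to letters
standing for print's objects: gauge invariance `hA` ([13] (3.29)), the representation `hrep` ([15] Prop. 9 ∕ (172)–(173)),
(41) [15] `h41`, (174) [15] `h174`, (171) [15] `h171` (⟸ (170)), «D = D^{(2)} + D₃, D^{(2)} = C^{(2)}» `hD`, `Δ₁` = the
operator of the (3.127) form `hΔ`, (3.128) `h3128`, (3.129) `h3129`, «RD*H₁B′ = 0» `hRh` ((3.110)), and the memberships
`Q𝒜₁ = 0`, `RD*𝒜₁ = 0` ((175) + (19)–(21) [15]).  On the exact-background lattice `hA` and `h41` are theorems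
(`B12ActionExpansion26Lattice.actionZ_gaugeTr`, `expansion41`). [cite: Balaban1987RG1, (2.6) p.266, (2.7) p.266, (2.8) p.266]
[cite: Balaban1985Variational, (41) p.284, (171) p.305, (174) p.305]
[cite: Balaban1985BackgroundPropagators, (3.127)-(3.129) p.421] -/
theorem eq28_at_eq3128 (D : Data 𝕜 V W X) {A : 𝒰 → 𝕜} (hA : ∀ (g : 𝒢) (U : 𝒰), A (g • U) = A U)
    {chart : W → 𝒰} {repB : 𝒰} {HfnB : W} (hrep : ∃ g : 𝒢, repB = g • chart HfnB)
    {U₁ : 𝒰} {β : W →ₗ[𝕜] W →ₗ[𝕜] 𝕜} (hsymm : ∀ x y, β x y = β y x) {V₀ : W → 𝕜}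
    (h41 : A (chart HfnB) = A U₁ + D.pairJ HfnB + (1 / 2 : 𝕜) * β HfnB HfnB + V₀ HfnB)
    {𝒜 : W → W} {Hk : N →ₗ[𝕜] W} {Dk : W → N} {B' : V}
    (h174 : HfnB = (D.H B' + 𝒜 (D.H B')) - Hk (Dk (D.H B' + 𝒜 (D.H B'))))
    (h171 : D.pairJ (𝒜 (D.H B')) = 0) {C₂ : W →ₗ[𝕜] W →ₗ[𝕜] N} (hC : ∀ x y, C₂ x y = C₂ y x) {D3 : W → N}
    (hD : ∀ Y : W, Dk Y = C₂ Y Y + D3 Y) (hΔ : D.Δ₁ = β - (2 : 𝕜) • C₂.compr₂ (D.pairJ ∘ₗ Hk))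
    {N' N'' : Type*} [AddCommGroup N'] [Module 𝕜 N'] [AddCommGroup N''] [Module 𝕜 N''] (Q : W →ₗ[𝕜] N')
    (RDstar : W →ₗ[𝕜] N'') (DGp : N'' →ₗ[𝕜] W) (pair : N' →ₗ[𝕜] N' →ₗ[𝕜] 𝕜) (hps : ∀ x y, pair x y = pair y x)
    (pairR : N'' →ₗ[𝕜] N'' →ₗ[𝕜] 𝕜) (α : 𝕜) (G1inv : W →ₗ[𝕜] W →ₗ[𝕜] 𝕜) (hGs : ∀ x y, G1inv x y = G1inv y x)
    (h3128 : ∀ A : W, G1inv A A = D.Δ₁ (A - DGp (RDstar A)) (A - DGp (RDstar A))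
      + pairR (RDstar A) (RDstar A) + α * pair (Q A) (Q A))
    {w : N'} (h3129 : ∀ a : W, G1inv a (D.H B') = pair (Q a) w) (hRh : RDstar (D.H B') = 0)
    (hQA₁ : Q (𝒜 (D.H B')) = 0) (hRA₁ : RDstar (𝒜 (D.H B')) = 0) :
    A repB = A U₁ + D.pairJ (D.H B') + (1 / 2 : 𝕜) * D.Δ₁ (D.H B') (D.H B')
      + V28fn D β V₀ 𝒜 Hk Dk D3 (D.H B') :=
  eq28_at_delta1 D hA hrep hsymm h41 h174 h171 hC hD hΔ Q RDstar pair (w - α • Q (D.H B'))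
    (lagrange_of_eq3128 D.Δ₁ G1inv (delta1_symm_of D hsymm Hk hC hΔ) hGs Q RDstar DGp pair hps pairR α h3128
      h3129 hRh)
    hQA₁ hRA₁

end Expansion

end Literature.MathematicalPhysics.QuantumFieldTheory.Balaban1983to89.B12ActionExpansion26
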